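/-
Copyright: literature port (parity-ideate cell, ROUND-22/24 Phase B).  Trunk: AntSieve / parity.S13.
-/
import Literature.NumberTheory.Sieve.PolymathProdRadialCert
import Literature.Computability.AlgebraicComplexity.MultinomialWords
import HarnessLib

/-!
# Product-radial certificates with LABELLED slots (`Sym_k[E]` for arbitrary one-variable profiles) —
# the analytic bridge (Polymath 8b, Lemma 7.2 / §7.1–7.2, for test functions built from several profiles)

D. H. J. Polymath, *Variants of the Selberg sieve, and bounded intervals containing many primes*, Res. Math. Sci. 1:12
(2014) = arXiv:1407.4897, Lemma 7.2 and §7.1–7.2.  The tree has two special cases of the §7 Gram-integral calculus: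
`PolymathBoundedGapsCert.lean` (labels = even MONOMIALS `t^{2s}`: `symmP`, `Esum`, `SymData`) and
`PolymathProdRadialCert.lean` (ONE profile `g` on every slot: `ProdData`).  This file is their common generalisation,
needed for the compressed "orbital" certificates (singly/doubly excited slots carrying arbitrary polynomial profiles
`o_1, …, o_r` over a base profile `g`):

* `symmL φ k m` — the labelled symmetric sum `Sym_k[m](t) = Σ_{σ : Fin k → Λ, lcnt σ = m} Π_i φ_{σ i}(t_i)` for a
  profile alphabet `φ : Λ → ℝ[X]` on any finite label type `Λ` (one label is the base profile `g`, carried by the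
  `k − #excited` unexcited slots); for
  monomial `φ s = X^{2s}` this is `symmP`, for `m = k·e_0` it is `Π_i g(t_i)`;
* `EsumL φ k m n ∈ ℝ[X]` — the orbit double sum `Σ_{σ ∈ adm m} Σ_{σ' ∈ adm n} Π_i hat(φ_{σ i} φ_{σ' i})`, with its
  POSITION RECURSION `EsumL_succ` (peel slot `0`: `E_{j+1}(m,n) = Σ_{s,t} hat(φ_s φ_t) · E_j(m − e_s, n − e_t)`) and
  base case `EsumL_zero` — the executable specification a kernel evaluator replays (dynamic programming over `j`, or,
  for signatures with ≤ 2 excited slots, the finitely many overlap classes);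
* the Gram integrals (Lemma 7.2 in product form, `setIntegral_scaledSimplex_prodForm` with slot-dependent profiles):
  `∫_{ρ•R_k} (ρ − Σt)^c Sym[m] Sym[n] = Λ_{k,c,ρ}(EsumL m n)`, polynomial and SHIFTED radial weights
  (`…_eval_mul_symmL_mul_symmL`, `…_evalShift_mul_symmL_mul_symmL`, via `shiftCoeff`);
* the peeling identity `symmL_insertNth` and the certificate calculus `SymLData` (signatures `sg p`, radial
  polynomials `Q_p`, profiles `φ`): `Φ = Σ_p Q_p(r − Σt) Sym[sg p]`, `I(1_{r•R_k}Φ)` (`SymLData.polymathI_cutoff_Phi`), the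
  inner integral `ψ` through the one-sided convolution transform `convT` of `PolymathProdRadialCert`
  (`SymLData.inner_integral`), `J_i = ∫ψ²` (`SymLData.polymathJ_cutoff_Phi`, `…_eq_sum`), and the assembly
  `SymLData.exists_polymathFunctional_gt_four` (`4·I < (k+1)·J ⇒ M_{k+1,ε} > 4`).

Pure analysis over the tree's API; no numerics, no new named facts.  The kernel checker for a concrete orbital
certificate (integer tables per overlap class, `decide +kernel`) is a separate file.

## References
* D. H. J. Polymath, Res. Math. Sci. 1 (2014), Art. 12; arXiv:1407.4897: Lemma 7.2, §7.1–7.2, Theorem 3.13. [Polymath8b2014]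
-/

open Polynomial MeasureTheory
open scoped BigOperators

namespace Literature.NumberTheory.Sieve.PolymathCert

/-! ### Assignments of labels to slots with prescribed multiplicities (generic label alphabet)

The tree's `cnt`/`admissible`/`sum_ladmissible_succ` (`PolymathBoundedGapsCert`) are hard-wired to the value type
`VT = Fin 16` of even monomials; the same elementary combinatorics for an arbitrary finite label alphabet `Λ`. -/

section LabelCombinatorics

variable {Λ : Type*} [Fintype Λ] [DecidableEq Λ]

/-- The multiplicity vector of a label assignment `σ : Fin k → Λ`. [cite: Polymath8b2014, Section 7.1] -/
def lcnt {k : ℕ} (σ : Fin k → Λ) : Λ → ℕ := fun s => (Finset.univ.filter fun i => σ i = s).card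

/-- The label assignments with prescribed multiplicities `m`. [cite: Polymath8b2014, Section 7.1] -/
def ladmissible (k : ℕ) (m : Λ → ℕ) : Finset (Fin k → Λ) := Finset.univ.filter fun σ => lcnt σ = m

omit [Fintype Λ] in
/-- `lcnt σ s` as a sum of indicators. [folklore] -/
private theorem lcnt_apply {k : ℕ} (σ : Fin k → Λ) (s : Λ) : lcnt σ s = ∑ i, if σ i = s then 1 else 0 := by
  rw [lcnt, Finset.card_filter]

omit [Fintype Λ] in
/-- Multiplicities after inserting one slot. [folklore] -/
private theorem lcnt_insertNth {k : ℕ} (i : Fin (k + 1)) (s : Λ) (σ' : Fin k → Λ) :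
    lcnt (i.insertNth s σ' : Fin (k + 1) → Λ) = Function.update (lcnt σ') s (lcnt σ' s + 1) := by
  ext t
  rw [lcnt_apply, Fin.sum_univ_succAbove _ i]
  simp only [Fin.insertNth_apply_same, Fin.insertNth_apply_succAbove]
  rw [← lcnt_apply]
  by_cases h : s = t
  · subst h; simp; ring
  · rw [if_neg h, Function.update_of_ne (Ne.symm h)]; simp

omit [Fintype Λ] in
/-- Arithmetic of removing one part from a multiplicity vector. [folklore] -/
private theorem update_lcnt_eq_iff {k : ℕ} (σ' : Fin k → Λ) (s : Λ) (m : Λ → ℕ) :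
    Function.update (lcnt σ') s (lcnt σ' s + 1) = m ↔ 1 ≤ m s ∧ lcnt σ' = Function.update m s (m s - 1) := by
  constructor
  · intro h
    have hs : m s = lcnt σ' s + 1 := by rw [← h]; simp
    refine ⟨by omega, ?_⟩
    ext t
    by_cases ht : t = s
    · subst ht; simp [hs]
    · rw [Function.update_of_ne ht, ← h, Function.update_of_ne ht]
  · rintro ⟨h1, h2⟩
    ext t
    by_cases ht : t = s
    · subst ht; rw [Function.update_self, h2, Function.update_self]; omega
    · rw [Function.update_of_ne ht, h2, Function.update_of_ne ht]

/-- **Peeling a slot**: summing over assignments `σ : Fin (k+1) → Λ` with multiplicities `m` = choosing the label `s`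
of slot `i` (`m s ≥ 1`) and an assignment of the other `k` slots with multiplicities `m − e_s`.
[cite: Polymath8b2014, Section 7.1] -/
theorem sum_ladmissible_succ {M : Type*} [AddCommMonoid M] {k : ℕ} (i : Fin (k + 1)) (m : Λ → ℕ)
    (f : (Fin (k + 1) → Λ) → M) :
    ∑ σ ∈ ladmissible (k + 1) m, f σ =
      ∑ s ∈ Finset.univ.filter (fun s : Λ => 1 ≤ m s),
        ∑ σ' ∈ ladmissible k (Function.update m s (m s - 1)), f (i.insertNth s σ') := by
  classical
  rw [ladmissible, Finset.sum_filter]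
  rw [← (Fin.insertNthEquiv (fun _ => Λ) i).sum_comp, Fintype.sum_prod_type, Finset.sum_filter]
  refine Finset.sum_congr rfl fun s _ => ?_
  change (∑ σ' : Fin k → Λ, if lcnt (i.insertNth s σ') = m then f (i.insertNth s σ') else 0) = _
  rw [ladmissible, Finset.sum_filter]
  by_cases hs : 1 ≤ m s
  · rw [if_pos hs]
    refine Finset.sum_congr rfl fun σ' _ => ?_
    have h := update_lcnt_eq_iff σ' s m
    rw [← lcnt_insertNth i] at h
    simp only [h, hs, true_and]
  · rw [if_neg hs]
    refine Finset.sum_eq_zero fun σ' _ => ?_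
    have h := update_lcnt_eq_iff σ' s m
    rw [← lcnt_insertNth i] at h
    rw [if_neg (fun h' => hs (h.1 h').1)]

omit [Fintype Λ] in
/-- With no slots all multiplicities vanish. [folklore] -/
private theorem lcnt_fin_zero (σ : Fin 0 → Λ) : lcnt σ = 0 := by
  ext s; simp [lcnt]

/-- Admissible assignments of zero slots. [folklore] -/
private theorem ladmissible_zero (m : Λ → ℕ) : ladmissible 0 m = if m = 0 then Finset.univ else ∅ := by
  ext σ
  simp only [ladmissible, Finset.mem_filter, Finset.mem_univ, true_and, lcnt_fin_zero]
  by_cases h : m = 0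
  · simp only [h, if_true, Finset.mem_univ]
  · simp only [if_neg h, Finset.notMem_empty, iff_false]
    exact fun h' => h h'.symm

end LabelCombinatorics

/-! ### Labelled symmetric sums -/

variable {Λ : Type*} [Fintype Λ] [DecidableEq Λ]

/-- **The labelled symmetric sum** `Sym_k[m](t) = Σ_{σ : lcnt σ = m} Π_i φ_{σ i}(t_i)` for a profile alphabet
`φ : Λ → ℝ[X]` and a multiplicity vector `m` (`m s` slots carry the profile `φ s`).  For `Λ = Fin 16`,
`φ s = X^{2s}` this is the monomial symmetric polynomial `symmP`. [cite: Polymath8b2014, Section 7.1] -/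
noncomputable def symmL (φ : Λ → ℝ[X]) (k : ℕ) (m : Λ → ℕ) (t : Fin k → ℝ) : ℝ :=
  ∑ σ ∈ ladmissible k m, ∏ i, (φ (σ i)).eval (t i)

/-- `Sym_k[m]` is continuous (a polynomial in `t`). [cite: Polymath8b2014, Section 7.1] -/
theorem continuous_symmL (φ : Λ → ℝ[X]) (k : ℕ) (m : Λ → ℕ) : Continuous (symmL φ k m) := by
  unfold symmL
  refine continuous_finsetSum _ fun σ _ => ?_
  exact continuous_finsetProd _ fun i _ => (Polynomial.continuous _).comp (continuous_apply i)

/-- **The orbit double sum** `E_k(m, n) = Σ_{σ ∈ adm m} Σ_{σ' ∈ adm n} Π_i hat(φ_{σ i} · φ_{σ' i}) ∈ ℝ[X]`, through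
which every Gram integral of labelled symmetric sums factors (Lemma 7.2 in product form).
[cite: Polymath8b2014, Section 7.1] -/
noncomputable def EsumL (φ : Λ → ℝ[X]) (k : ℕ) (m n : Λ → ℕ) : ℝ[X] :=
  ∑ σ ∈ ladmissible k m, ∑ σ' ∈ ladmissible k n, ∏ i, hat (φ (σ i) * φ (σ' i))

/-- **The basic Gram integral with a monomial radial weight**:
`∫_{ρ•R_k} (ρ − Σt)^c · Sym[m](t) Sym[n](t) dt = Λ_{k,c,ρ}(E_k(m,n))`. [cite: Polymath8b2014, Lemma 7.2] -/
theorem setIntegral_scaledSimplex_pow_mul_symmL_mul_symmL (φ : Λ → ℝ[X]) (k : ℕ) {ρ : ℝ} (hρ : 0 ≤ ρ)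
    (c : ℕ) (m n : Λ → ℕ) :
    ∫ t in scaledSimplex k ρ, (ρ - ∑ i, t i) ^ c * (symmL φ k m t * symmL φ k n t) =
      simplexFunctional k c ρ (EsumL φ k m n) := by
  have hexp : ∀ t : Fin k → ℝ, (ρ - ∑ i, t i) ^ c * (symmL φ k m t * symmL φ k n t) =
      ∑ σ ∈ ladmissible k m, ∑ σ' ∈ ladmissible k n,
        (ρ - ∑ i, t i) ^ c * ∏ i, (φ (σ i) * φ (σ' i)).eval (t i) := by
    intro t
    rw [symmL, symmL, Finset.sum_mul_sum, Finset.mul_sum]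
    refine Finset.sum_congr rfl fun σ _ => ?_
    rw [Finset.mul_sum]
    refine Finset.sum_congr rfl fun σ' _ => ?_
    rw [← Finset.prod_mul_distrib]
    simp only [Polynomial.eval_mul]
  simp_rw [hexp]
  have hint : ∀ (σ σ' : Fin k → Λ), IntegrableOn
      (fun t : Fin k → ℝ => (ρ - ∑ i, t i) ^ c * ∏ i, (φ (σ i) * φ (σ' i)).eval (t i)) (scaledSimplex k ρ) :=
    fun σ σ' => (continuous_prodForm k c (fun i => φ (σ i) * φ (σ' i)) ρ).continuousOn.integrableOn_compact
      (isCompact_scaledSimplex k ρ)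
  rw [integral_finsetSum _ (fun σ _ => integrable_finsetSum _ fun σ' _ => hint σ σ'), EsumL, map_sum]
  refine Finset.sum_congr rfl fun σ _ => ?_
  rw [integral_finsetSum _ (fun σ' _ => hint σ σ'), map_sum]
  refine Finset.sum_congr rfl fun σ' _ => ?_
  exact setIntegral_scaledSimplex_prodForm c k (fun i => φ (σ i) * φ (σ' i)) ρ hρ

/-- **Gram integral with a polynomial radial weight**:
`∫_{ρ•R_k} q(ρ − Σt) Sym[m] Sym[n] dt = Σ_{c<B} q_c · Λ_{k,c,ρ}(E_k(m,n))` (`deg q < B`). [cite: Polymath8b2014, Section 7.1] -/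
theorem setIntegral_scaledSimplex_eval_mul_symmL_mul_symmL (φ : Λ → ℝ[X]) (k : ℕ) {ρ : ℝ} (hρ : 0 ≤ ρ)
    (q : ℝ[X]) {B : ℕ} (hB : q.natDegree < B) (m n : Λ → ℕ) :
    ∫ t in scaledSimplex k ρ, q.eval (ρ - ∑ i, t i) * (symmL φ k m t * symmL φ k n t) =
      ∑ c ∈ Finset.range B, q.coeff c * simplexFunctional k c ρ (EsumL φ k m n) := by
  have hexp : ∀ t : Fin k → ℝ, q.eval (ρ - ∑ i, t i) * (symmL φ k m t * symmL φ k n t) =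
      ∑ c ∈ Finset.range B, q.coeff c * ((ρ - ∑ i, t i) ^ c * (symmL φ k m t * symmL φ k n t)) := by
    intro t
    rw [Polynomial.eval_eq_sum_range' hB, Finset.sum_mul]
    refine Finset.sum_congr rfl fun c _ => ?_
    ring
  simp_rw [hexp]
  have hint : ∀ c, IntegrableOn
      (fun t : Fin k → ℝ => q.coeff c * ((ρ - ∑ i, t i) ^ c * (symmL φ k m t * symmL φ k n t)))
      (scaledSimplex k ρ) := by
    intro c
    refine (Continuous.continuousOn ?_).integrableOn_compact (isCompact_scaledSimplex k ρ)
    refine continuous_const.mul (Continuous.mul ?_ ((continuous_symmL φ k m).mul (continuous_symmL φ k n)))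
    exact (continuous_const.sub (continuous_finsetSum _ fun i _ => continuous_apply i)).pow c
  rw [integral_finsetSum _ (fun c _ => hint c)]
  refine Finset.sum_congr rfl fun c _ => ?_
  rw [integral_const_mul, setIntegral_scaledSimplex_pow_mul_symmL_mul_symmL φ k hρ c m n]

/-- **Shifted Gram integral** (the `J`-side after the binomial re-expansion `U(d + x) = Σ_c shiftCoeff_c x^c`):
`∫_{ρ•R_k} U(d + (ρ − Σt)) Sym[m] Sym[n] dt = Σ_{c<B} shiftCoeff(U,d)_c · Λ_{k,c,ρ}(E_k(m,n))`.
[cite: Polymath8b2014, Section 7.2] -/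
theorem setIntegral_scaledSimplex_evalShift_mul_symmL_mul_symmL (φ : Λ → ℝ[X]) (k : ℕ) {ρ : ℝ} (hρ : 0 ≤ ρ)
    (d : ℝ) (U : ℝ[X]) {B : ℕ} (hB : U.natDegree < B) (m n : Λ → ℕ) :
    ∫ t in scaledSimplex k ρ, U.eval (d + (ρ - ∑ i, t i)) * (symmL φ k m t * symmL φ k n t) =
      ∑ c ∈ Finset.range B, shiftCoeff U B d c * simplexFunctional k c ρ (EsumL φ k m n) := by
  have hexp : ∀ t : Fin k → ℝ, U.eval (d + (ρ - ∑ i, t i)) * (symmL φ k m t * symmL φ k n t) =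
      ∑ c ∈ Finset.range B, shiftCoeff U B d c * ((ρ - ∑ i, t i) ^ c * (symmL φ k m t * symmL φ k n t)) := by
    intro t
    rw [eval_add_eq_sum_shiftCoeff U hB, Finset.sum_mul]
    refine Finset.sum_congr rfl fun c _ => ?_
    ring
  simp_rw [hexp]
  have hint : ∀ c, IntegrableOn
      (fun t : Fin k → ℝ => shiftCoeff U B d c * ((ρ - ∑ i, t i) ^ c * (symmL φ k m t * symmL φ k n t)))
      (scaledSimplex k ρ) := by
    intro c
    refine (Continuous.continuousOn ?_).integrableOn_compact (isCompact_scaledSimplex k ρ)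
    refine continuous_const.mul (Continuous.mul ?_ ((continuous_symmL φ k m).mul (continuous_symmL φ k n)))
    exact (continuous_const.sub (continuous_finsetSum _ fun i _ => continuous_apply i)).pow c
  rw [integral_finsetSum _ (fun c _ => hint c)]
  refine Finset.sum_congr rfl fun c _ => ?_
  rw [integral_const_mul, setIntegral_scaledSimplex_pow_mul_symmL_mul_symmL φ k hρ c m n]

/-! ### Peeling one slot, and the position recursion of `E_k` -/

/-- **Peeling a slot**: `Sym_{k+1}[m](insertNth i v t') = Σ_{s : m_s ≥ 1} φ_s(v) · Sym_k[m − e_s](t')`.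
[cite: Polymath8b2014, Section 7.2] -/
theorem symmL_insertNth (φ : Λ → ℝ[X]) {k : ℕ} (i : Fin (k + 1)) (m : Λ → ℕ) (v : ℝ) (t' : Fin k → ℝ) :
    symmL φ (k + 1) m (i.insertNth v t') =
      ∑ s ∈ Finset.univ.filter (fun s : Λ => 1 ≤ m s),
        (φ s).eval v * symmL φ k (Function.update m s (m s - 1)) t' := by
  rw [symmL, sum_ladmissible_succ i]
  refine Finset.sum_congr rfl fun s _ => ?_
  rw [symmL, Finset.mul_sum]
  refine Finset.sum_congr rfl fun σ' _ => ?_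
  rw [Fin.prod_univ_succAbove _ i]
  simp only [Fin.insertNth_apply_same, Fin.insertNth_apply_succAbove]

/-- Base of the position recursion: `E_0(m, n) = [m = 0 ∧ n = 0]` (as a constant polynomial).
[cite: Polymath8b2014, Section 7.1] -/
theorem EsumL_zero (φ : Λ → ℝ[X]) (m n : Λ → ℕ) :
    EsumL φ 0 m n = if m = 0 ∧ n = 0 then 1 else 0 := by
  rw [EsumL, ladmissible_zero, ladmissible_zero]
  by_cases hm : m = 0
  · by_cases hn : n = 0
    · simp [hm, hn]
    · simp [hm, hn]
  · simp [hm]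

/-- **Position recursion** of the orbit sums (peel slot `0` from both assignments):
`E_{j+1}(m, n) = Σ_{s : m_s ≥ 1} Σ_{t : n_t ≥ 1} hat(φ_s φ_t) · E_j(m − e_s, n − e_t)` — the identity a kernel
evaluator iterates. [cite: Polymath8b2014, Section 7.1] -/
theorem EsumL_succ (φ : Λ → ℝ[X]) (j : ℕ) (m n : Λ → ℕ) :
    EsumL φ (j + 1) m n =
      ∑ s ∈ Finset.univ.filter (fun s : Λ => 1 ≤ m s), ∑ t ∈ Finset.univ.filter (fun t : Λ => 1 ≤ n t),
        hat (φ s * φ t) * EsumL φ j (Function.update m s (m s - 1)) (Function.update n t (n t - 1)) := by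
  rw [EsumL, sum_ladmissible_succ 0 m]
  refine Finset.sum_congr rfl fun s _ => ?_
  have inner : ∀ σ2 : Fin j → Λ,
      ∑ σ' ∈ ladmissible (j + 1) n, ∏ i, hat (φ ((Fin.insertNth 0 s σ2 : Fin (j + 1) → Λ) i) * φ (σ' i)) =
        ∑ t ∈ Finset.univ.filter (fun t : Λ => 1 ≤ n t),
          ∑ σ3 ∈ ladmissible j (Function.update n t (n t - 1)),
            hat (φ s * φ t) * ∏ i, hat (φ (σ2 i) * φ (σ3 i)) := by
    intro σ2
    rw [sum_ladmissible_succ 0 n]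
    refine Finset.sum_congr rfl fun t _ => Finset.sum_congr rfl fun σ3 _ => ?_
    rw [Fin.prod_univ_succAbove _ 0]
    simp only [Fin.insertNth_apply_same, Fin.insertNth_apply_succAbove]
  simp_rw [inner]
  rw [Finset.sum_comm]
  refine Finset.sum_congr rfl fun t _ => ?_
  rw [EsumL, Finset.mul_sum]
  refine Finset.sum_congr rfl fun σ2 _ => ?_
  rw [Finset.mul_sum]

/-- `E_k` is symmetric in its two signatures up to the order of the factors: `E_k(n, m) = E_k(m, n)`.
[cite: Polymath8b2014, Section 7.1] -/
theorem EsumL_comm (φ : Λ → ℝ[X]) (k : ℕ) (m n : Λ → ℕ) : EsumL φ k n m = EsumL φ k m n := by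
  rw [EsumL, EsumL, Finset.sum_comm]
  refine Finset.sum_congr rfl fun σ _ => Finset.sum_congr rfl fun σ' _ => ?_
  refine Finset.prod_congr rfl fun i _ => ?_
  rw [mul_comm]

/-! ### Overlap classes: `E_k(m, n)` as a finite sum over joint-multiplicity matrices

Pairing the two assignments slot by slot, `(σ, σ') ↦ τ = (σ_i, σ'_i)_i : Fin k → Λ × Λ`, the summand
`Π_i hat(φ_{σ i} φ_{σ' i}) = Π_{(s,t)} hat(φ_s φ_t)^{M(s,t)}` depends only on the joint multiplicities
`M = jcnt τ`; the number of `τ` with `jcnt τ = M` is the multinomial coefficient `k!/Π M(s,t)!`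
(`card_words_eq_multinomial`).  Hence `E_k(m,n) = Σ_{M} (k!/Π M!) · Π_{(s,t)} hat(φ_s φ_t)^{M(s,t)}` over the
realised matrices `M` (row sums `m`, column sums `n`): for signatures with few excited slots these are the finitely
many OVERLAP CLASSES, each a product of ONE big power `hat(φ_0 φ_0)^{M(0,0)}` and a few small factors — the shape a
kernel certificate tabulates.  A supplied list of classes is COMPLETE as soon as its multinomial weights add up to
`#adm(m) · #adm(n)` (`jointClasses_eq_of_sum_multinomial_eq`). -/

/-- Slotwise pairing of two assignments. [folklore] -/
def pairA {k : ℕ} (σσ' : (Fin k → Λ) × (Fin k → Λ)) : Fin k → Λ × Λ := fun i => (σσ'.1 i, σσ'.2 i)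

/-- Joint multiplicities `M(s,t) = #{i : τ i = (s,t)}` of a paired assignment. [cite: Polymath8b2014, Section 7.1] -/
def jcnt {k : ℕ} (τ : Fin k → Λ × Λ) : Λ × Λ → ℕ := fun p => (Finset.univ.filter fun i => τ i = p).card

/-- The overlap classes of the signature pair `(m, n)` on `k` slots: the joint-multiplicity matrices realised by
pairs of admissible assignments. [cite: Polymath8b2014, Section 7.1] -/
def jointClasses (k : ℕ) (m n : Λ → ℕ) : Finset (Λ × Λ → ℕ) :=
  (ladmissible k m ×ˢ ladmissible k n).image fun σσ' => jcnt (pairA σσ')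

/-- A slotwise product regroups by joint multiplicities: `Π_i H(τ i) = Π_p H(p)^{M(p)}`. [folklore] -/
private theorem prod_eq_prod_pow_jcnt {k : ℕ} (H : Λ × Λ → ℝ[X]) (τ : Fin k → Λ × Λ) :
    ∏ i, H (τ i) = ∏ p, H p ^ jcnt τ p := by
  rw [← Finset.prod_fiberwise Finset.univ τ (fun i => H (τ i))]
  refine Finset.prod_congr rfl fun p _ => ?_
  rw [Finset.prod_congr rfl (fun i hi => by rw [(Finset.mem_filter.1 hi).2]), Finset.prod_const]
  rfl

/-- Row sums of the joint multiplicities are the multiplicities of the first assignment. [folklore] -/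
private theorem lcnt_fst_eq_sum_jcnt {k : ℕ} (τ : Fin k → Λ × Λ) (s : Λ) :
    lcnt (fun i => (τ i).1) s = ∑ t, jcnt τ (s, t) := by
  rw [lcnt, Finset.card_eq_sum_card_fiberwise (f := fun i => (τ i).2) (t := Finset.univ) (fun _ _ => Finset.mem_univ _)]
  refine Finset.sum_congr rfl fun t _ => ?_
  rw [jcnt, Finset.filter_filter]
  congr 1
  ext i
  simp [Prod.ext_iff]

/-- Column sums of the joint multiplicities are the multiplicities of the second assignment. [folklore] -/
private theorem lcnt_snd_eq_sum_jcnt {k : ℕ} (τ : Fin k → Λ × Λ) (t : Λ) :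
    lcnt (fun i => (τ i).2) t = ∑ s, jcnt τ (s, t) := by
  rw [lcnt, Finset.card_eq_sum_card_fiberwise (f := fun i => (τ i).1) (t := Finset.univ) (fun _ _ => Finset.mem_univ _)]
  refine Finset.sum_congr rfl fun s _ => ?_
  rw [jcnt, Finset.filter_filter]
  congr 1
  ext i
  simp [Prod.ext_iff, and_comm]

/-- The joint multiplicities add up to the number of slots. [folklore] -/
private theorem sum_jcnt {k : ℕ} (τ : Fin k → Λ × Λ) : ∑ p, jcnt τ p = k := by
  have h := Finset.card_eq_sum_card_fiberwise (s := (Finset.univ : Finset (Fin k))) (f := τ) (t := Finset.univ)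
    (fun _ _ => Finset.mem_univ _)
  rw [Finset.card_univ, Fintype.card_fin] at h
  exact h.symm

/-- Membership in the class set: a realised matrix has row sums `m` and column sums `n` and total `k`.
[cite: Polymath8b2014, Section 7.1] -/
theorem marginals_of_mem_jointClasses {k : ℕ} {m n : Λ → ℕ} {M : Λ × Λ → ℕ} (hM : M ∈ jointClasses k m n) :
    (∑ p, M p = k) ∧ (∀ s, ∑ t, M (s, t) = m s) ∧ (∀ t, ∑ s, M (s, t) = n t) := by
  obtain ⟨σσ', hσσ', rfl⟩ := Finset.mem_image.1 hM
  obtain ⟨hσ, hσ'⟩ := Finset.mem_product.1 hσσ'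
  have h1 : lcnt σσ'.1 = m := (Finset.mem_filter.1 hσ).2
  have h2 : lcnt σσ'.2 = n := (Finset.mem_filter.1 hσ').2
  refine ⟨sum_jcnt _, fun s => ?_, fun t => ?_⟩
  · rw [← lcnt_fst_eq_sum_jcnt, ← h1]; rfl
  · rw [← lcnt_snd_eq_sum_jcnt, ← h2]; rfl

/-- The words with prescribed joint multiplicities `M`. [folklore] -/
private theorem filter_jcnt_eq (k : ℕ) (M : Λ × Λ → ℕ) :
    (Finset.univ.filter fun τ : Fin k → Λ × Λ => jcnt τ = M) =
      Finset.univ.filter fun τ : Fin k → Λ × Λ => ∀ p, (Finset.univ.filter fun i => τ i = p).card = M p := by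
  refine Finset.filter_congr fun τ _ => ?_
  rw [funext_iff]
  rfl

/-- **The size of an overlap class is the multinomial coefficient** `k!/Π_{(s,t)} M(s,t)!`.
[cite: Polymath8b2014, Section 7.1] -/
theorem card_fiber_jcnt_eq_multinomial {k : ℕ} {m n : Λ → ℕ} {M : Λ × Λ → ℕ} (hM : M ∈ jointClasses k m n) :
    ((ladmissible k m ×ˢ ladmissible k n).filter fun σσ' => jcnt (pairA σσ') = M).card =
      Nat.multinomial Finset.univ M := by
  obtain ⟨hk, hrow, hcol⟩ := marginals_of_mem_jointClasses hM
  have hw := Literature.Computability.AlgebraicComplexity.card_words_eq_multinomial k M hk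
  rw [← filter_jcnt_eq] at hw
  rw [← hw]
  refine Finset.card_bij' (fun σσ' _ => pairA σσ') (fun τ _ => (fun i => (τ i).1, fun i => (τ i).2))
    (fun σσ' h => ?_) (fun τ hτ => ?_) (fun σσ' _ => ?_) (fun τ _ => ?_)
  · exact Finset.mem_filter.2 ⟨Finset.mem_univ _, (Finset.mem_filter.1 h).2⟩
  · have hτM : jcnt τ = M := (Finset.mem_filter.1 hτ).2
    refine Finset.mem_filter.2 ⟨Finset.mem_product.2 ⟨?_, ?_⟩, ?_⟩
    · refine Finset.mem_filter.2 ⟨Finset.mem_univ _, funext fun s => ?_⟩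
      rw [lcnt_fst_eq_sum_jcnt, hτM, hrow]
    · refine Finset.mem_filter.2 ⟨Finset.mem_univ _, funext fun t => ?_⟩
      rw [lcnt_snd_eq_sum_jcnt, hτM, hcol]
    · rw [← hτM]; rfl
  · rfl
  · rfl

/-- **`E_k(m, n)` over overlap classes**:
`E_k(m,n) = Σ_{M ∈ jointClasses} (k!/Π M(s,t)!) · Π_{(s,t)} hat(φ_s φ_t)^{M(s,t)}`. [cite: Polymath8b2014, Section 7.1] -/
theorem EsumL_eq_sum_jointClasses (φ : Λ → ℝ[X]) (k : ℕ) (m n : Λ → ℕ) :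
    EsumL φ k m n =
      ∑ M ∈ jointClasses k m n, Nat.multinomial Finset.univ M • ∏ p : Λ × Λ, hat (φ p.1 * φ p.2) ^ M p := by
  have h1 : EsumL φ k m n = ∑ σσ' ∈ ladmissible k m ×ˢ ladmissible k n,
      (fun M : Λ × Λ → ℕ => ∏ p : Λ × Λ, hat (φ p.1 * φ p.2) ^ M p) (jcnt (pairA σσ')) := by
    rw [EsumL, Finset.sum_product]
    refine Finset.sum_congr rfl fun σ _ => Finset.sum_congr rfl fun σ' _ => ?_
    exact prod_eq_prod_pow_jcnt (fun p : Λ × Λ => hat (φ p.1 * φ p.2)) (pairA (σ, σ'))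
  rw [h1, Finset.sum_comp (fun M : Λ × Λ → ℕ => ∏ p : Λ × Λ, hat (φ p.1 * φ p.2) ^ M p)
    (fun σσ' : (Fin k → Λ) × (Fin k → Λ) => jcnt (pairA σσ'))]
  refine Finset.sum_congr rfl fun M hM => ?_
  rw [card_fiber_jcnt_eq_multinomial hM]

/-- The number of admissible assignments with multiplicities `m` (`Σ m = k`) is `k!/Π m_s!`. [cite: Polymath8b2014, Section 7.1] -/
theorem card_ladmissible_eq_multinomial {k : ℕ} {m : Λ → ℕ} (hm : ∑ s, m s = k) :
    (ladmissible k m).card = Nat.multinomial Finset.univ m := by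
  have h := Literature.Computability.AlgebraicComplexity.card_words_eq_multinomial k m hm
  have e : ladmissible k m =
      Finset.univ.filter fun σ : Fin k → Λ => ∀ v, (Finset.univ.filter fun t => σ t = v).card = m v := by
    ext σ
    simp only [ladmissible, Finset.mem_filter, Finset.mem_univ, true_and, funext_iff]
    rfl
  rw [e]
  convert h using 2

/-- **Mass identity of the classes**: `Σ_{M ∈ jointClasses} k!/Π M! = #adm(m) · #adm(n)` (every pair of admissible
assignments lies in exactly one class). [cite: Polymath8b2014, Section 7.1] -/
theorem sum_multinomial_jointClasses (k : ℕ) (m n : Λ → ℕ) :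
    ∑ M ∈ jointClasses k m n, Nat.multinomial Finset.univ M = (ladmissible k m).card * (ladmissible k n).card := by
  rw [← Finset.card_product, jointClasses,
    Finset.card_eq_sum_card_image (fun σσ' : (Fin k → Λ) × (Fin k → Λ) => jcnt (pairA σσ'))]
  refine Finset.sum_congr rfl fun M hM => ?_
  rw [card_fiber_jcnt_eq_multinomial hM]

/-- A matrix with the right marginals IS realised (there is a word with any prescribed letter counts).
[cite: Polymath8b2014, Section 7.1] -/
theorem mem_jointClasses_of_marginals {k : ℕ} {m n : Λ → ℕ} {M : Λ × Λ → ℕ} (hk : ∑ p, M p = k)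
    (hrow : ∀ s, ∑ t, M (s, t) = m s) (hcol : ∀ t, ∑ s, M (s, t) = n t) : M ∈ jointClasses k m n := by
  have hpos : 0 < (Finset.univ.filter fun τ : Fin k → Λ × Λ => jcnt τ = M).card := by
    rw [filter_jcnt_eq, Literature.Computability.AlgebraicComplexity.card_words_eq_multinomial k M hk]
    exact Nat.multinomial_pos _ _
  obtain ⟨τ, hτ⟩ := Finset.card_pos.1 hpos
  have hτM : jcnt τ = M := (Finset.mem_filter.1 hτ).2
  refine Finset.mem_image.2 ⟨(fun i => (τ i).1, fun i => (τ i).2), Finset.mem_product.2 ⟨?_, ?_⟩, ?_⟩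
  · refine Finset.mem_filter.2 ⟨Finset.mem_univ _, funext fun s => ?_⟩
    rw [lcnt_fst_eq_sum_jcnt, hτM, hrow]
  · refine Finset.mem_filter.2 ⟨Finset.mem_univ _, funext fun t => ?_⟩
    rw [lcnt_snd_eq_sum_jcnt, hτM, hcol]
  · rw [← hτM]; rfl

/-- **Completeness of a supplied class list by mass**: if every listed matrix has the right marginals, the list has
no duplicates, and its multinomial weights add up to `#adm(m) · #adm(n)`, then the list IS the set of overlap classes
(all weights being positive). This is the check a kernel certificate performs instead of enumerating classes.
[cite: Polymath8b2014, Section 7.1] -/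
theorem jointClasses_eq_of_sum_multinomial_eq {k : ℕ} {m n : Λ → ℕ} (L : Finset (Λ × Λ → ℕ))
    (hL : ∀ M ∈ L, (∑ p, M p = k) ∧ (∀ s, ∑ t, M (s, t) = m s) ∧ (∀ t, ∑ s, M (s, t) = n t))
    (hmass : ∑ M ∈ L, Nat.multinomial Finset.univ M = (ladmissible k m).card * (ladmissible k n).card) :
    L = jointClasses k m n := by
  have hsub : L ⊆ jointClasses k m n := fun M hM =>
    mem_jointClasses_of_marginals (hL M hM).1 (hL M hM).2.1 (hL M hM).2.2
  refine Finset.eq_of_subset_of_card_le hsub ?_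
  by_contra hlt
  rw [not_le] at hlt
  obtain ⟨M, hMj, hML⟩ := Finset.exists_mem_notMem_of_card_lt_card hlt
  have hlt' : ∑ M ∈ L, Nat.multinomial Finset.univ M < ∑ M ∈ jointClasses k m n, Nat.multinomial Finset.univ M :=
    Finset.sum_lt_sum_of_subset hsub hMj hML (Nat.multinomial_pos _ _) (fun M _ _ => Nat.zero_le _)
  rw [sum_multinomial_jointClasses, hmass] at hlt'
  exact lt_irrefl _ hlt'

/-! ### The certificate calculus for `F = 1_{r•R_k} · Σ_p Q_p(r − Σt) · Sym_k[sg p](t)` -/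

/-- Labelled product-radial certificate data (proof side): a profile alphabet `φ` (`φ 0` = base profile), and
finitely many generators `p`, each a signature `sg p` (which profiles sit on how many slots) with a radial
polynomial `Q_p`. [cite: Polymath8b2014, Section 7.2] -/
structure SymLData (Λ : Type*) [Fintype Λ] [DecidableEq Λ] (ι : Type*) where
  /-- degree bound of the radial polynomials -/
  A : ℕ
  /-- degree bound of the profiles -/
  S : ℕ
  /-- the profile alphabet -/
  φ : Λ → ℝ[X]
  /-- the signature of generator `p` -/
  sg : ι → (Λ → ℕ)
  /-- the radial polynomial of generator `p` -/
  Q : ι → ℝ[X]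
  /-- `deg φ_s ≤ S` -/
  degφ : ∀ s, (φ s).natDegree ≤ S
  /-- `deg Q_p ≤ A` -/
  degQ : ∀ p, (Q p).natDegree ≤ A

variable {ι : Type*} [Fintype ι]

/-- `Φ(t) = Σ_p Q_p(r − Σ_i t_i) · Sym_k[sg p](t)`. [cite: Polymath8b2014, Section 7.2] -/
noncomputable def SymLData.Phi (D : SymLData Λ ι) (k : ℕ) (r : ℝ) (t : Fin k → ℝ) : ℝ :=
  ∑ p, (D.Q p).eval (r - ∑ i, t i) * symmL D.φ k (D.sg p) t

/-- `Φ` is continuous (a polynomial). [cite: Polymath8b2014, Section 7.2] -/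
theorem SymLData.continuous_Phi (D : SymLData Λ ι) (k : ℕ) (r : ℝ) : Continuous (D.Phi k r) := by
  unfold SymLData.Phi
  refine continuous_finsetSum _ fun p _ => Continuous.mul ?_ (continuous_symmL _ k _)
  exact (Polynomial.continuous _).comp (continuous_const.sub (continuous_finsetSum _ fun i _ => continuous_apply i))

/-- **`I(F)`** for the labelled certificate function: `I(1_{r•R_k}Φ) = Σ_{p,q} Σ_{c<B} (Q_pQ_q)_c · Λ_{k,c,r}(E_k(sg p, sg q))`.
[cite: Polymath8b2014, Section 7.1] -/
theorem SymLData.polymathI_cutoff_Phi (D : SymLData Λ ι) (k : ℕ) {r : ℝ} (hr : 0 ≤ r) {B : ℕ}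
    (hB : ∀ p q, (D.Q p * D.Q q).natDegree < B) :
    polymathI k (cutoff k r (D.Phi k r)) =
      ∑ p, ∑ q, ∑ c ∈ Finset.range B,
        (D.Q p * D.Q q).coeff c * simplexFunctional k c r (EsumL D.φ k (D.sg p) (D.sg q)) := by
  rw [polymathI_cutoff]
  have hexp : ∀ t : Fin k → ℝ, D.Phi k r t ^ 2 =
      ∑ p, ∑ q, (D.Q p * D.Q q).eval (r - ∑ i, t i) * (symmL D.φ k (D.sg p) t * symmL D.φ k (D.sg q) t) := by
    intro t
    rw [sq, SymLData.Phi, Finset.sum_mul_sum]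
    refine Finset.sum_congr rfl fun p _ => Finset.sum_congr rfl fun q _ => ?_
    rw [Polynomial.eval_mul]; ring
  simp_rw [hexp]
  have hint : ∀ p q, IntegrableOn (fun t : Fin k → ℝ =>
      (D.Q p * D.Q q).eval (r - ∑ i, t i) * (symmL D.φ k (D.sg p) t * symmL D.φ k (D.sg q) t))
      (scaledSimplex k r) := by
    intro p q
    refine (Continuous.continuousOn ?_).integrableOn_compact (isCompact_scaledSimplex k r)
    refine Continuous.mul ?_ ((continuous_symmL _ k _).mul (continuous_symmL _ k _))
    exact (Polynomial.continuous _).comp (continuous_const.sub (continuous_finsetSum _ fun i _ => continuous_apply i))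
  rw [integral_finsetSum _ (fun p _ => integrable_finsetSum _ fun q _ => hint p q)]
  refine Finset.sum_congr rfl fun p _ => ?_
  rw [integral_finsetSum _ (fun q _ => hint p q)]
  refine Finset.sum_congr rfl fun q _ => ?_
  exact setIntegral_scaledSimplex_eval_mul_symmL_mul_symmL D.φ k hr _ (hB p q) _ _

/-- **The inner integral** `ψ(t') = Σ_p Σ_{s : sg p s ≥ 1} (T_{φ_s} Q_p)(r − Σ_j t'_j) · Sym_k[sg p − e_s](t')`, where
`T_φ Q = convT A S φ Q` is the one-sided convolution transform (`∫₀ᴿ Q(R − v) φ(v) dv = (T_φ Q)(R)`).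
[cite: Polymath8b2014, Section 7.2] -/
noncomputable def SymLData.psi (D : SymLData Λ ι) (k : ℕ) (r : ℝ) (t' : Fin k → ℝ) : ℝ :=
  ∑ p, ∑ s ∈ Finset.univ.filter (fun s : Λ => 1 ≤ D.sg p s),
    (convT D.A D.S (D.φ s) (D.Q p)).eval (r - ∑ j, t' j) * symmL D.φ k (Function.update (D.sg p) s (D.sg p s - 1)) t'

/-- `ψ` is continuous (a polynomial). [cite: Polymath8b2014, Section 7.2] -/
theorem SymLData.continuous_psi (D : SymLData Λ ι) (k : ℕ) (r : ℝ) : Continuous (D.psi k r) := by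
  unfold SymLData.psi
  refine continuous_finsetSum _ fun p _ => continuous_finsetSum _ fun s _ => Continuous.mul ?_ (continuous_symmL _ k _)
  exact (Polynomial.continuous _).comp (continuous_const.sub (continuous_finsetSum _ fun i _ => continuous_apply i))

/-- **Inner integral** of the certificate function along coordinate `i`: for `t' ∈ r' • R_k`, `r' ≤ r`,
`∫_{v>0} F(insertNth i v t') dv = ψ(t')`. [cite: Polymath8b2014, Section 7.2] -/
theorem SymLData.inner_integral (D : SymLData Λ ι) (k : ℕ) (i : Fin (k + 1)) {r r' : ℝ} (hr : r' ≤ r)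
    {t' : Fin k → ℝ} (ht' : t' ∈ scaledSimplex k r') :
    ∫ v in Set.Ioi (0 : ℝ), cutoff (k + 1) r (D.Phi (k + 1) r) (i.insertNth v t') = D.psi k r t' := by
  rw [integral_Ioi_cutoff_insertNth i hr _ ht']
  set R := r - ∑ j, t' j with hR
  have hexp : ∀ v : ℝ, D.Phi (k + 1) r (i.insertNth v t') =
      ∑ p, ∑ s ∈ Finset.univ.filter (fun s : Λ => 1 ≤ D.sg p s),
        (D.Q p).eval (R - v) * (D.φ s).eval v * symmL D.φ k (Function.update (D.sg p) s (D.sg p s - 1)) t' := by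
    intro v
    rw [SymLData.Phi]
    refine Finset.sum_congr rfl fun p _ => ?_
    rw [Fin.sum_univ_succAbove _ i]
    simp only [Fin.insertNth_apply_same, Fin.insertNth_apply_succAbove]
    rw [symmL_insertNth D.φ i, Finset.mul_sum]
    refine Finset.sum_congr rfl fun s _ => ?_
    rw [show r - (v + ∑ j, t' j) = R - v by rw [hR]; ring]
    ring
  simp_rw [hexp]
  rw [intervalIntegral.integral_finsetSum (fun p _ => ?_)]
  · rw [SymLData.psi]
    refine Finset.sum_congr rfl fun p _ => ?_
    rw [intervalIntegral.integral_finsetSum (fun s _ => ?_)]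
    · refine Finset.sum_congr rfl fun s _ => ?_
      rw [intervalIntegral.integral_mul_const, integral_eval_sub_mul_eval (D.degφ s) (D.degQ p)]
    · exact (Continuous.intervalIntegrable (by fun_prop) _ _)
  · refine Continuous.intervalIntegrable ?_ _ _
    exact continuous_finsetSum _ fun s _ => by fun_prop

/-- **`J_{i,r'}(F) = ∫_{r'•R_k} ψ²`**, the same for every `i`. [cite: Polymath8b2014, Section 7.2] -/
theorem SymLData.polymathJ_cutoff_Phi (D : SymLData Λ ι) (k : ℕ) (i : Fin (k + 1)) {r r' : ℝ} (hr : r' ≤ r) :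
    polymathJ (k + 1) r' i (cutoff (k + 1) r (D.Phi (k + 1) r)) = ∫ t' in scaledSimplex k r', D.psi k r t' ^ 2 :=
  polymathJ_eq_of_inner i r' _ (D.continuous_psi k r) fun _ ht' => D.inner_integral k i hr ht'

/-- **`J` of the certificate function** as a finite sum over pointed generators, with the shift `d = r − r'`:
`J_{i,r'}(F) = Σ_{(p,s)} Σ_{(q,t)} Σ_{c<B} shiftCoeff(T_{φ_s}Q_p · T_{φ_t}Q_q, d)_c · Λ_{k,c,r'}(E_k(sg p − e_s, sg q − e_t))`.
[cite: Polymath8b2014, Section 7.2] -/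
theorem SymLData.polymathJ_cutoff_Phi_eq_sum (D : SymLData Λ ι) (k : ℕ) (i : Fin (k + 1)) {r r' : ℝ}
    (hr : r' ≤ r) (hr' : 0 ≤ r') {B : ℕ}
    (hB : ∀ p q (s t : Λ), (convT D.A D.S (D.φ s) (D.Q p) * convT D.A D.S (D.φ t) (D.Q q)).natDegree < B) :
    polymathJ (k + 1) r' i (cutoff (k + 1) r (D.Phi (k + 1) r)) =
      ∑ p, ∑ s ∈ Finset.univ.filter (fun s : Λ => 1 ≤ D.sg p s),
        ∑ q, ∑ t ∈ Finset.univ.filter (fun t : Λ => 1 ≤ D.sg q t),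
          ∑ c ∈ Finset.range B,
            shiftCoeff (convT D.A D.S (D.φ s) (D.Q p) * convT D.A D.S (D.φ t) (D.Q q)) B (r - r') c *
              simplexFunctional k c r'
                (EsumL D.φ k (Function.update (D.sg p) s (D.sg p s - 1)) (Function.update (D.sg q) t (D.sg q t - 1))) := by
  rw [D.polymathJ_cutoff_Phi k i hr]
  have hexp : ∀ t' : Fin k → ℝ, D.psi k r t' ^ 2 =
      ∑ p, ∑ s ∈ Finset.univ.filter (fun s : Λ => 1 ≤ D.sg p s),
        ∑ q, ∑ t ∈ Finset.univ.filter (fun t : Λ => 1 ≤ D.sg q t),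
          (convT D.A D.S (D.φ s) (D.Q p) * convT D.A D.S (D.φ t) (D.Q q)).eval ((r - r') + (r' - ∑ j, t' j)) *
            (symmL D.φ k (Function.update (D.sg p) s (D.sg p s - 1)) t' *
              symmL D.φ k (Function.update (D.sg q) t (D.sg q t - 1)) t') := by
    intro t'
    rw [sq, SymLData.psi, Finset.sum_mul_sum]
    refine Finset.sum_congr rfl fun p _ => ?_
    simp_rw [Finset.sum_mul_sum]
    rw [Finset.sum_comm]
    refine Finset.sum_congr rfl fun s _ => Finset.sum_congr rfl fun q _ => Finset.sum_congr rfl fun t _ => ?_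
    rw [Polynomial.eval_mul, show r - r' + (r' - ∑ j, t' j) = r - ∑ j, t' j by ring]
    ring
  simp_rw [hexp]
  have hint : ∀ (U : ℝ[X]) (m n : Λ → ℕ), IntegrableOn (fun t' : Fin k → ℝ =>
      U.eval ((r - r') + (r' - ∑ j, t' j)) * (symmL D.φ k m t' * symmL D.φ k n t')) (scaledSimplex k r') := by
    intro U m n
    refine (Continuous.continuousOn ?_).integrableOn_compact (isCompact_scaledSimplex k r')
    refine Continuous.mul ?_ ((continuous_symmL _ k _).mul (continuous_symmL _ k _))
    exact (Polynomial.continuous _).comp (by fun_prop)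
  rw [integral_finsetSum _ (fun p _ => integrable_finsetSum _ fun s _ =>
    integrable_finsetSum _ fun q _ => integrable_finsetSum _ fun t _ => hint _ _ _)]
  refine Finset.sum_congr rfl fun p _ => ?_
  rw [integral_finsetSum _ (fun s _ => integrable_finsetSum _ fun q _ => integrable_finsetSum _ fun t _ => hint _ _ _)]
  refine Finset.sum_congr rfl fun s _ => ?_
  rw [integral_finsetSum _ (fun q _ => integrable_finsetSum _ fun t _ => hint _ _ _)]
  refine Finset.sum_congr rfl fun q _ => ?_
  rw [integral_finsetSum _ (fun t _ => hint _ _ _)]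
  refine Finset.sum_congr rfl fun t _ => ?_
  exact setIntegral_scaledSimplex_evalShift_mul_symmL_mul_symmL D.φ k hr' (r - r') _ (hB p q s t) _ _

/-- **Assembly**: a labelled product-radial certificate for `M_{k+1,ε} > 4`.  The hypotheses are the two CLOSED FORMS
(values `Ival`, `Jval`, certified elsewhere by exact arithmetic) and the two inequalities `0 < I`, `4·I < (k+1)·J`.
[cite: Polymath8b2014, Theorem 3.12] -/
theorem SymLData.exists_polymathFunctional_gt_four (D : SymLData Λ ι) (k : ℕ) {ε : ℝ} (hε0 : 0 < ε) (hε1 : ε < 1)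
    {BI BJ : ℕ} (hBI : ∀ p q, (D.Q p * D.Q q).natDegree < BI)
    (hBJ : ∀ p q (s t : Λ), (convT D.A D.S (D.φ s) (D.Q p) * convT D.A D.S (D.φ t) (D.Q q)).natDegree < BJ)
    {Ival Jval : ℝ}
    (hI : ∑ p, ∑ q, ∑ c ∈ Finset.range BI,
        (D.Q p * D.Q q).coeff c * simplexFunctional (k + 1) c (1 + ε) (EsumL D.φ (k + 1) (D.sg p) (D.sg q)) = Ival)
    (hJ : ∑ p, ∑ s ∈ Finset.univ.filter (fun s : Λ => 1 ≤ D.sg p s),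
        ∑ q, ∑ t ∈ Finset.univ.filter (fun t : Λ => 1 ≤ D.sg q t),
          ∑ c ∈ Finset.range BJ,
            shiftCoeff (convT D.A D.S (D.φ s) (D.Q p) * convT D.A D.S (D.φ t) (D.Q q)) BJ (2 * ε) c *
              simplexFunctional k c (1 - ε)
                (EsumL D.φ k (Function.update (D.sg p) s (D.sg p s - 1)) (Function.update (D.sg q) t (D.sg q t - 1))) =
          Jval)
    (hIpos : 0 < Ival) (hcert : 4 * Ival < (k + 1 : ℝ) * Jval) :
    ∃ F : (Fin (k + 1) → ℝ) → ℝ, IsPolymathTestFunction (k + 1) ε F ∧ 4 < polymathFunctional (k + 1) ε F := by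
  have hIeq : polymathI (k + 1) (cutoff (k + 1) (1 + ε) (D.Phi (k + 1) (1 + ε))) = Ival := by
    rw [D.polymathI_cutoff_Phi (k + 1) (by linarith) hBI, hI]
  have hJeq : ∀ i : Fin (k + 1),
      polymathJ (k + 1) (1 - ε) i (cutoff (k + 1) (1 + ε) (D.Phi (k + 1) (1 + ε))) = Jval := by
    intro i
    rw [D.polymathJ_cutoff_Phi_eq_sum k i (by linarith : 1 - ε ≤ 1 + ε) (by linarith : (0 : ℝ) ≤ 1 - ε) hBJ,
      show (1 + ε) - (1 - ε) = 2 * ε by ring, hJ]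
  have hIpos' : 0 < polymathI (k + 1) (cutoff (k + 1) (1 + ε) (D.Phi (k + 1) (1 + ε))) := by
    rw [hIeq]; exact hIpos
  refine ⟨_, isPolymathTestFunction_cutoff (D.continuous_Phi (k + 1) (1 + ε)) hIpos', ?_⟩
  have hsum : ∑ i : Fin (k + 1), polymathJ (k + 1) (1 - ε) i (cutoff (k + 1) (1 + ε) (D.Phi (k + 1) (1 + ε))) =
      (k + 1 : ℝ) * Jval := by
    rw [Finset.sum_congr rfl (fun i _ => hJeq i), Finset.sum_const, Finset.card_univ, Fintype.card_fin]
    simp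
  rw [polymathFunctional, hsum, hIeq, lt_div_iff₀ hIpos]
  linarith

end Literature.NumberTheory.Sieve.PolymathCert
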